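import Literature.Computability.MetaComplexity.NWTableGenerator
import Literature.Computability.MetaComplexity.AvgHardTablesNP
import Literature.Computability.Complexity.PromiseMA
import Literature.Computability.Complexity.PairPlumbing
import HarnessLib

/-!
# `pr-MA = pr-NP` under `coNP × {U} ⊆ Avg¹_{1-n^{-c}} P` (Köbler–Schuler; Hirahara 2021, Lemma 3.4, item 2)

Topic `Literature/Computability/MetaComplexity`. Item 2 of the proof sketch of Hirahara's Lemma 3.4
(ECCC TR21-058, p. 20):

> "2. `coNP × {U} ⊆ Avg¹_{1-n^{-c}} P` implies `pr-MA = pr-NP` [KS04]."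

PROVED here (`Hirahara2021_PromiseMA'_eq_PromiseNP_of_Avg1P`, with `MA ⊆ NP` as a corollary), as the
assembly of three proved ingredients of the tree:

* the Köbler–Schuler certifier of AVERAGE-case hard truth tables extracted from the one-sided heuristic
  for the `coNP` property "no circuit of size `2^{⌊ℓ/8⌋}` agrees with the table on a `1/2 + 2^{-⌊ℓ/8⌋}`
  fraction" (`AvgHardTablesNP.lean`: `Hirahara2021_exists_avgCertifier_of_Avg1P` — polynomial time,
  sound, and accepting SOME table of every large arity);
* the Nisan–Wigderson generator armed with a table, in the exponential regime (`NWTableGenerator.lean`: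
  `NWTable.genTF ∈ FP`, `NWTable.isSizePseudorandom_genTF`: `O(log N)` seed bits, fools size `N` with
  error `1/N` whenever the table is `2^{3t}`-hard on average, `t = ⌊log₂ N⌋ + 1`, arity `24t`);
* the counting of Arora–Barak's Lemma 20.3 (`PRGDerandomization.lean`: the distinguisher with the input
  hard-wired, `exists_circuit_hardwire`; seeds versus coins, `PRGDerand.card_random_eq_uniformProb`).

The simulation (namespace `KSDerand`; the textbook `MA ⊆ NP`-from-a-generator argument, Goldreich–Zuckerman
/ IKW §2.4, with Merlin ALSO supplying the hard table): for `Q ∈ pr-MA` with referee `R ∈ P` and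
move length `p`, the `NP` verifier reads `⟨x, ⟨y', ρ'⟩⟩`, normalises Merlin's message `y = y' ↾ p(|x|)`
and table `ρ = ρ' ↾ 2^ℓ` (`ℓ = 24 t`, `N = Nb(|x|)` a polynomial output length exceeding the
distinguisher size), REJECTS unless the certifier accepts `ρ`, and otherwise accepts iff a majority of
the `2^{O(log N)}` seeds `s` make `R(x, y, G_ρ(s) ↾ p(|x|))` accept. On a yes-instance Merlin sends a good
`y` and a certified table (one exists at every large arity); on a no-instance EVERY certified table is
hard, so the generator fools Arthur's predicate for every `y` and no witness is accepted. As recorded in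
`AvgHardTables.lean`, certifying average-case hardness directly is a shortcut relative to the printed
chain KS04 (worst-case hardness + Impagliazzo–Wigderson amplification); the statement proved is the
printed one.

Main results: `KSDerand.Ver ∈ P` and its reading `KSDerand.mem_Ver_iff`; the gap lemma
`KSDerand.abs_sub_le`; **`PromiseMA'_subset_PromiseNP_of_avgCertifier`** (from any sound, eventually
non-empty polynomial-time certifier of `2^{⌊ℓ/8⌋}`-average-case hardness);
**`Hirahara2021_PromiseMA'_subset_PromiseNP_of_Avg1P`**, **`Hirahara2021_PromiseMA'_eq_PromiseNP_of_Avg1P`**,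
**`Hirahara2021_MA_subset_NP_of_Avg1P`** (under Hirahara's hypothesis `coNP × {U, T} ⊆ Avg¹_{1-n^{-c}} P`),
and the same from the uniform half alone (`PromiseMA'_eq_PromiseNP_of_uniform`).

How this is consumed (for whoever proves item 3, the remaining leaf `Hirahara2021_hardE_of_lemma37` /
BFP Lemma 3.7 under Hirahara's hypothesis): either through the printed interface `pr-MA = pr-NP`
(then a `pr-MA`-complete problem is needed to keep the nondeterministic overhead uniform in `ε`), or —
closer to [BFP05]'s own proof — by re-running the simulation of this file at time scale `2^{O(ε)n}`
with the same two ingredients, the certifier (`Hirahara2021_exists_avgCertifier_of_Avg1P`) and the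
table generator (`NWTable.genTF`, `NWTable.isSizePseudorandom_genTF`), which are stated scale-free.

Everything is proved; definitions are the verifier bricks. No named fact is introduced (D-0026).
Nothing duplicates the tree (searched `PromiseMA`, `MA ⊆ NP`, `Kobler`, `derandomiz.*Merlin`: the
nondeterministic simulation of `MA` in the tree is IKW's Thm. 12 machine, `IKWSimulationMachine.lean`,
for GENERATED tables in the polynomial regime — a different statement).

## References

* S. Hirahara, *Average-case hardness of NP from exponential worst-case hardness assumptions*,
  ECCC TR21-058 (2021), Lemma 3.4, proof sketch, item 2 (p. 20) [Hirahara2021].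
* J. Köbler, R. Schuler, *Average-case intractability vs. worst-case intractability*, Inform. and
  Comput. 190 (2004) 1–17 (the cited source [KS04]).
* R. Impagliazzo, V. Kabanets, A. Wigderson, JCSS 65 (2002), §2.4 (nondeterministic simulation of `MA`
  from a quick generator) [ImpagliazzoKabanetsWigderson2002].
* S. Arora, B. Barak, *Computational Complexity: A Modern Approach*, CUP 2009, Lemma 20.3 (proof),
  Thm. 20.6, Def. 8.10 [AroraBarakCC2009].
-/

noncomputable section

namespace Literature.Computability.MetaComplexity

open _root_.Computability Polynomial Finset Complexity Complexity.Classes Complexity.Nondeterministic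
  Complexity.Brick Complexity.Plumb Complexity.NWMachine NWTable AvgHardTables

namespace KSDerand

/-! ### Helpers

The pointwise forms `NWTable.pairF_mem_FP` / `NWTable.compF_mem_FP` (`NWTableGenerator.lean`) and
`append_mem_FP` (`FPStringBricks.lean`) are used for bricks written as lambdas. -/

/-- A list of the stated length is its own padded prefix. [folklore] -/
theorem takeD_of_length_eq {a : List Bool} {m : ℕ} (ha : a.length = m) : a.takeD m false = a := by
  subst ha
  rw [List.takeD_eq_take _ le_rfl, List.take_length]

/-! ### The parameters -/

/-- The block-length factor `a = 24` of the generator (`n = 24 t`, hardness `2^{⌊n/8⌋} = 2^{3t}`). [folklore] -/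
def aK : ℕ := 24

/-- The alphabet exponent `β = a + 1 = 25`. [folklore] -/
def bK : ℕ := 25

/-- The arity of the table at output length `N`: `ℓ(N) = 24 t(N)`, `t(N) = ⌊log₂ N⌋ + 1` (reducible, so
that tables of arity `ℓ(N)` are tables of arity `aK * tOf N`). [folklore] -/
abbrev ellOf (N : ℕ) : ℕ := aK * tOf N

/-- The seed length at output length `N`: `k(N) = 2^25 ℓ(N)`. [folklore] -/
def kOf (N : ℕ) : ℕ := 2 ^ bK * ellOf N

/-- The table-length ruler polynomial `2^24 (X + 1)^24 ≥ 2^{ℓ(N)}`. [folklore] -/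
def Tpoly : Polynomial ℕ := C (2 ^ aK) * (X + 1) ^ aK

/-- `2^{ℓ(N)} ≤ Tpoly(N)` (since `2^{t(N)} ≤ 2(N+1)`). [folklore] -/
theorem two_pow_ellOf_le (N : ℕ) : 2 ^ ellOf N ≤ Tpoly.eval N := by
  unfold ellOf Tpoly
  rw [eval_mul, eval_C, eval_pow, eval_add, eval_X, eval_one, mul_comm aK, pow_mul, ← mul_pow]
  exact Nat.pow_le_pow_left (two_pow_tOf_le N) _

/-- `2^{k(N)} ≤ seedPoly(2^25 · 24)(N)`. [folklore] -/
theorem two_pow_kOf_le (N : ℕ) : 2 ^ kOf N ≤ (PRGDerand.seedPoly (2 ^ bK * aK)).eval N := by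
  rw [PRGDerand.seedPoly_eval, kOf, ellOf, ← mul_assoc, mul_comm (2 ^ bK * aK), pow_mul, ← mul_pow]
  exact Nat.pow_le_pow_left (two_pow_tOf_le N) _

/-! ### The verifier, brick by brick -/

section Machine

variable (R : Language Bool) (p : Polynomial ℕ) (A : List Bool → ℕ → Bool) (Nb : Polynomial ℕ)

/-- Merlin's message, normalised: `z = ⟨x, u⟩ ↦ y = (fst u) ↾ p(|x|)`. [folklore] -/
def yF : List Bool → List Bool := fun z =>
  fstP (padTakeFn (boolPair (polyFn p (fstP z)) (fstP (sndP z))))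

/-- The arity in unary: `z ↦ 1^{ℓ(N)}`, `N = Nb(|x|)` (`1^{24(⌊log₂ N⌋ + 1)}`). [folklore] -/
def lU : List Bool → List Bool := fun z => onesMulFn aK (true :: logFn (polyFn Nb (fstP z)))

/-- The table length as a numeral: `z ↦ bin 2^{ℓ(N)} = 0^{ℓ} 1`. [folklore] -/
def TnumF : List Bool → List Bool := fun z => Kannan.zerosFn (lU Nb z) ++ [true]

/-- The table length in unary: `z ↦ 1^{2^{ℓ(N)}}` (on the ruler `1^{Tpoly(N)}`). [folklore] -/
def TU : List Bool → List Bool := fun z =>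
  binToUnaryFn (boolPair (polyFn Tpoly (polyFn Nb (fstP z))) (TnumF Nb z))

/-- The table, normalised: `z ↦ ρ = (snd u) ↾ 2^{ℓ(N)}`. [folklore] -/
def rhoF : List Bool → List Bool := fun z => fstP (padTakeFn (boolPair (TU Nb z) (sndP (sndP z))))

/-- The certifier as a string function on `⟨w, 1ⁿ⟩` (second component read by its length). [folklore] -/
def runA : List Bool → List Bool := fun w => encodeBool (A (boolUnpair w).1 (boolUnpair w).2.length)

/-- The certificate bit: `z ↦ [A(ρ; 1^{2^ℓ})]`. [cite: Hirahara2021, Lemma 3.4 (proof sketch, item 2)] -/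
def certF : List Bool → List Bool := fun z => runA A (boolPair (rhoF Nb z) (TU Nb z))

/-- The seed length in unary: `z ↦ 1^{k(N)}`. [folklore] -/
def kU : List Bool → List Bool := fun z => onesMulFn (2 ^ bK) (lU Nb z)

/-- The number of seeds as a numeral: `z ↦ bin 2^{k(N)}`. [folklore] -/
def cntNumF : List Bool → List Bool := fun z => Kannan.zerosFn (kU Nb z) ++ [true]

/-- On a round `w = ⟨z, 1ⁱ⟩`: the `i`-th seed `takeD k (bin i)`. [folklore] -/
def seedF : List Bool → List Bool := fun w =>
  fstP (padTakeFn (boolPair (kU Nb (fstP w)) (lenBinF (sndP w))))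

/-- On a round: the generator's output `G_ρ(seedᵢ) = genTF ⟨ρ, ⟨1^N, seedᵢ⟩⟩`.
[cite: AroraBarakCC2009, Lemma 20.3 (proof)] -/
def genOutF : List Bool → List Bool := fun w =>
  genTF aK bK (boolPair (rhoF Nb (fstP w)) (boolPair (polyFn Nb (fstP (fstP w))) (seedF Nb w)))

/-- On a round: Arthur's coins `G_ρ(seedᵢ) ↾ p(|x|)`. [folklore] -/
def coinsF : List Bool → List Bool := fun w =>
  fstP (padTakeFn (boolPair (polyFn p (fstP (fstP w))) (genOutF Nb w)))

/-- **The piece of round `i`**: `[⟨⟨x, y⟩, G_ρ(seedᵢ) ↾ p(|x|)⟩ ∈ R]` as a one-symbol numeral.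
[cite: AroraBarakCC2009, Lemma 20.3 (proof)] -/
def pieceF : List Bool → List Bool := fun w =>
  encodeBool (R.boolIndicator (boolPair (boolPair (fstP (fstP w)) (yF p (fstP w))) (coinsF p Nb w)))

/-- **The number of accepting seeds**, as a numeral: the counted fold over `i < 2^{k(N)}`.
[cite: AroraBarakCC2009, Lemma 20.3 (proof)] -/
def accF : List Bool → List Bool := fun z =>
  sndPow 2 (foldLoop addFn (clipF 1 (pieceF R p Nb)) ((PRGDerand.seedPoly (2 ^ bK * aK)).comp Nb)
    (boolPair z (boolPair (cntNumF Nb z) (boolPair [] []))))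

/-- **The majority bit** `[2^k < 2 · #accepting seeds]`. [cite: AroraBarakCC2009, Lemma 20.3 (proof)] -/
def majF : List Bool → List Bool := fun z =>
  ltFn (boolPair (cntNumF Nb z) (addFn (boolPair (accF R p Nb z) (accF R p Nb z))))

/-- **The verifier language**: the certifier accepts the table AND a majority of seeds accept.
[cite: Hirahara2021, Lemma 3.4 (proof sketch, item 2)] -/
def Ver : Language Bool :=
  {z | certF A Nb z = (fun _ => [true]) z} ⊓ {z | majF R p Nb z = (fun _ => [true]) z}

/-! #### Membership in `FP` / `P` -/

variable {R A}

/-- `yF ∈ FP`. [folklore] -/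
theorem yF_mem_FP : yF p ∈ FP :=
  compF_mem_FP (g := fstP) fstP_mem_FP (compF_mem_FP (g := padTakeFn) padTakeFn_mem_FP
    (NWTable.pairF_mem_FP (compF_mem_FP (g := polyFn p) (polyFn_mem_FP p) fstP_mem_FP)
      (compF_mem_FP (g := fstP) fstP_mem_FP sndP_mem_FP)))

/-- `lU ∈ FP`. [folklore] -/
theorem lU_mem_FP : lU Nb ∈ FP :=
  compF_mem_FP (g := onesMulFn aK) (onesMulFn_mem_FP aK)
    (compF_mem_FP (g := List.cons true) (cons_mem_FP true)
      (compF_mem_FP (g := logFn) logFn_mem_FP (compF_mem_FP (g := polyFn Nb) (polyFn_mem_FP Nb) fstP_mem_FP)))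

/-- `TnumF ∈ FP`. [folklore] -/
theorem TnumF_mem_FP : TnumF Nb ∈ FP :=
  append_mem_FP (compF_mem_FP (g := Kannan.zerosFn) Kannan.zerosFn_mem_FP (lU_mem_FP Nb)) (const_mem_FP _)

/-- `TU ∈ FP`. [folklore] -/
theorem TU_mem_FP : TU Nb ∈ FP :=
  compF_mem_FP (g := binToUnaryFn) binToUnaryFn_mem_FP
    (NWTable.pairF_mem_FP (compF_mem_FP (g := polyFn Tpoly) (polyFn_mem_FP Tpoly)
      (compF_mem_FP (g := polyFn Nb) (polyFn_mem_FP Nb) fstP_mem_FP)) (TnumF_mem_FP Nb))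

/-- `rhoF ∈ FP`. [folklore] -/
theorem rhoF_mem_FP : rhoF Nb ∈ FP :=
  compF_mem_FP (g := fstP) fstP_mem_FP (compF_mem_FP (g := padTakeFn) padTakeFn_mem_FP
    (NWTable.pairF_mem_FP (TU_mem_FP Nb) (compF_mem_FP (g := sndP) sndP_mem_FP sndP_mem_FP)))

/-- The certifier's string function is in `FP` (its machine behind the unary-argument normaliser,
`mem_FP_of_unaryArg`). [cite: AroraBarakCC2009, §1.3] -/
theorem runA_mem_FP (hA : PolyTimeComputable paramEnc encodeBool (Function.uncurry A)) : runA A ∈ FP :=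
  mem_FP_of_unaryArg hA

/-- `certF ∈ FP` for a polynomial-time certifier. [folklore] -/
theorem certF_mem_FP (hA : PolyTimeComputable paramEnc encodeBool (Function.uncurry A)) : certF A Nb ∈ FP :=
  compF_mem_FP (g := runA A) (runA_mem_FP hA) (NWTable.pairF_mem_FP (rhoF_mem_FP Nb) (TU_mem_FP Nb))

/-- `kU ∈ FP`. [folklore] -/
theorem kU_mem_FP : kU Nb ∈ FP := compF_mem_FP (g := onesMulFn (2 ^ bK)) (onesMulFn_mem_FP _) (lU_mem_FP Nb)

/-- `cntNumF ∈ FP`. [folklore] -/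
theorem cntNumF_mem_FP : cntNumF Nb ∈ FP :=
  append_mem_FP (compF_mem_FP (g := Kannan.zerosFn) Kannan.zerosFn_mem_FP (kU_mem_FP Nb)) (const_mem_FP _)

/-- `seedF ∈ FP`. [folklore] -/
theorem seedF_mem_FP : seedF Nb ∈ FP :=
  compF_mem_FP (g := fstP) fstP_mem_FP (compF_mem_FP (g := padTakeFn) padTakeFn_mem_FP
    (NWTable.pairF_mem_FP (compF_mem_FP (g := kU Nb) (kU_mem_FP Nb) fstP_mem_FP) (compF_mem_FP (g := lenBinF) lenBinF_mem_FP sndP_mem_FP)))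

/-- `genOutF ∈ FP` (the table generator is polynomial time, `genTF_mem_FP`). [folklore] -/
theorem genOutF_mem_FP : genOutF Nb ∈ FP :=
  compF_mem_FP (g := genTF aK bK) (genTF_mem_FP aK bK)
    (NWTable.pairF_mem_FP (compF_mem_FP (g := rhoF Nb) (rhoF_mem_FP Nb) fstP_mem_FP)
      (NWTable.pairF_mem_FP (compF_mem_FP (g := polyFn Nb) (polyFn_mem_FP Nb) (compF_mem_FP (g := fstP) fstP_mem_FP fstP_mem_FP))
        (seedF_mem_FP Nb)))

/-- `coinsF ∈ FP`. [folklore] -/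
theorem coinsF_mem_FP : coinsF p Nb ∈ FP :=
  compF_mem_FP (g := fstP) fstP_mem_FP (compF_mem_FP (g := padTakeFn) padTakeFn_mem_FP
    (NWTable.pairF_mem_FP (compF_mem_FP (g := polyFn p) (polyFn_mem_FP p) (compF_mem_FP (g := fstP) fstP_mem_FP fstP_mem_FP))
      (genOutF_mem_FP Nb)))

/-- `pieceF ∈ FP` for `R ∈ P`. [cite: AroraBarakCC2009, §1.3 (composition)] -/
theorem pieceF_mem_FP (hR : R ∈ Classes.P) : pieceF R p Nb ∈ FP :=
  compF_mem_FP (g := fun w => encodeBool (R.boolIndicator w)) (indicatorFn_mem_FP hR)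
    (NWTable.pairF_mem_FP (NWTable.pairF_mem_FP (compF_mem_FP (g := fstP) fstP_mem_FP fstP_mem_FP)
      (compF_mem_FP (g := yF p) (yF_mem_FP p) fstP_mem_FP)) (coinsF_mem_FP p Nb))

/-- The piece is one symbol long on every input. [folklore] -/
theorem length_pieceF (w : List Bool) : (pieceF R p Nb w).length = 1 := by
  unfold pieceF
  simp [encodeBool]

/-- `accF ∈ FP` for `R ∈ P` (the fold loop with an additive-growth operation and a clipped piece).
[cite: AroraBarakCC2009, §1.3 (bounded loops)] -/
theorem accF_mem_FP (hR : R ∈ Classes.P) : accF R p Nb ∈ FP :=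
  compF_mem_FP (g := sndPow 2) (sndPow_mem_FP 2)
    (compF_mem_FP (g := foldLoop addFn (clipF 1 (pieceF R p Nb)) ((PRGDerand.seedPoly (2 ^ bK * aK)).comp Nb))
      (foldLoop_clipF_mem_FP 1 addFn_mem_FP length_addFn_le (pieceF_mem_FP p Nb hR) _)
      (NWTable.pairF_mem_FP (PolyTimeComputable.id _) (NWTable.pairF_mem_FP (cntNumF_mem_FP Nb) (const_mem_FP _))))

/-- `majF ∈ FP` for `R ∈ P`. [folklore] -/
theorem majF_mem_FP (hR : R ∈ Classes.P) : majF R p Nb ∈ FP :=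
  compF_mem_FP (g := ltFn) ltFn_mem_FP (NWTable.pairF_mem_FP (cntNumF_mem_FP Nb)
    (compF_mem_FP (g := addFn) addFn_mem_FP (NWTable.pairF_mem_FP (accF_mem_FP p Nb hR) (accF_mem_FP p Nb hR))))

/-- **The verifier is polynomial time.** [cite: Hirahara2021, Lemma 3.4 (proof sketch, item 2)] -/
theorem Ver_mem_P (hR : R ∈ Classes.P) (hA : PolyTimeComputable paramEnc encodeBool (Function.uncurry A)) :
    Ver R p A Nb ∈ Classes.P :=
  inter_mem_P (setOf_apply_eq_apply_mem_P (certF_mem_FP Nb hA) (const_mem_FP _))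
    (setOf_apply_eq_apply_mem_P (majF_mem_FP p Nb hR) (const_mem_FP _))

/-! #### Values on `z = ⟨x, u⟩` -/

variable (R A)

/-- Value of `yF`: Merlin's normalised message. [folklore] -/
theorem yF_apply (x u : List Bool) : yF p (boolPair x u) = (fstP u).takeD (p.eval x.length) false := by
  unfold yF
  rw [fstP_boolPair, sndP_boolPair, polyFn_apply, padTakeFn_boolPair, fstP_boolPair]
  simp [ones]

/-- Value of `lU`: `1^{ℓ(N)}`. [folklore] -/
theorem lU_apply (x u : List Bool) : lU Nb (boolPair x u) = ones (ellOf (Nb.eval x.length)) := by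
  unfold lU
  rw [fstP_boolPair, polyFn_apply]
  simp [logFn, onesMulFn, ones, ellOf, tOf, Nat.mul_succ]

/-- Value of `TnumF`: `bin 2^{ℓ(N)}`. [folklore] -/
theorem TnumF_apply (x u : List Bool) : TnumF Nb (boolPair x u) = encodeNat (2 ^ ellOf (Nb.eval x.length)) := by
  unfold TnumF
  rw [lU_apply, Kannan.zerosFn_apply, Com.encodeNat_two_pow]
  simp [ones]

/-- Value of `TU`: `1^{2^{ℓ(N)}}`. [folklore] -/
theorem TU_apply (x u : List Bool) : TU Nb (boolPair x u) = ones (2 ^ ellOf (Nb.eval x.length)) := by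
  unfold TU
  rw [fstP_boolPair, polyFn_apply, polyFn_apply, TnumF_apply, binToUnaryFn_boolPair, bitsToNat_encodeNat]
  simp only [ones, List.length_replicate]
  rw [min_eq_left (two_pow_ellOf_le _)]

/-- Value of `rhoF`: the normalised table. [folklore] -/
theorem rhoF_apply (x u : List Bool) :
    rhoF Nb (boolPair x u) = (sndP u).takeD (2 ^ ellOf (Nb.eval x.length)) false := by
  unfold rhoF
  rw [TU_apply, sndP_boolPair, padTakeFn_boolPair, fstP_boolPair]
  simp [ones]

/-- Value of `certF`: the certifier's bit on the normalised table at its own length. [folklore] -/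
theorem certF_apply (x u : List Bool) :
    certF A Nb (boolPair x u) =
      [A ((sndP u).takeD (2 ^ ellOf (Nb.eval x.length)) false) (2 ^ ellOf (Nb.eval x.length))] := by
  unfold certF runA
  rw [rhoF_apply, TU_apply, boolUnpair_boolPair]
  simp [ones, encodeBool]

/-- Value of `kU`: `1^{k(N)}`. [folklore] -/
theorem kU_apply (x u : List Bool) : kU Nb (boolPair x u) = ones (kOf (Nb.eval x.length)) := by
  unfold kU
  rw [lU_apply]
  simp [onesMulFn, ones, kOf]

/-- Value of `cntNumF`: `bin 2^{k(N)}`. [folklore] -/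
theorem cntNumF_apply (x u : List Bool) : cntNumF Nb (boolPair x u) = encodeNat (2 ^ kOf (Nb.eval x.length)) := by
  unfold cntNumF
  rw [kU_apply, Kannan.zerosFn_apply, Com.encodeNat_two_pow]
  simp [ones]

/-- Value of `seedF` on round `i`: `takeD k (bin i)`. [folklore] -/
theorem seedF_apply (x u : List Bool) (i : ℕ) :
    seedF Nb (boolPair (boolPair x u) (ones i)) = (encodeNat i).takeD (kOf (Nb.eval x.length)) false := by
  unfold seedF
  rw [fstP_boolPair, sndP_boolPair, kU_apply, lenBinF_apply, padTakeFn_boolPair, fstP_boolPair]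
  simp [ones]

/-- The generator output on the `i`-th seed. [folklore] -/
def genOut (x u : List Bool) (i : ℕ) : List Bool :=
  genTF aK bK (boolPair ((sndP u).takeD (2 ^ ellOf (Nb.eval x.length)) false)
    (boolPair (ones (Nb.eval x.length)) ((encodeNat i).takeD (kOf (Nb.eval x.length)) false)))

/-- Value of `genOutF` on round `i`. [folklore] -/
theorem genOutF_apply (x u : List Bool) (i : ℕ) :
    genOutF Nb (boolPair (boolPair x u) (ones i)) = genOut Nb x u i := by
  unfold genOutF genOut
  rw [fstP_boolPair, rhoF_apply, fstP_boolPair, polyFn_apply, seedF_apply]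

/-- Value of `coinsF` on round `i`. [folklore] -/
theorem coinsF_apply (x u : List Bool) (i : ℕ) :
    coinsF p Nb (boolPair (boolPair x u) (ones i)) = (genOut Nb x u i).takeD (p.eval x.length) false := by
  unfold coinsF
  rw [fstP_boolPair, fstP_boolPair, polyFn_apply, genOutF_apply, padTakeFn_boolPair, fstP_boolPair]
  simp [ones]

/-- **Value of the piece of round `i`.** [folklore] -/
theorem pieceF_apply (x u : List Bool) (i : ℕ) :
    pieceF R p Nb (boolPair (boolPair x u) (ones i)) =
      [R.boolIndicator (boolPair (boolPair x ((fstP u).takeD (p.eval x.length) false))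
        ((genOut Nb x u i).takeD (p.eval x.length) false))] := by
  unfold pieceF
  rw [fstP_boolPair, fstP_boolPair, yF_apply, coinsF_apply]
  simp [encodeBool]

/-- **The count of accepting seeds, for an arbitrary generator `F` on `⟨1^N, σ⟩`** (the shape of
`PRGDerand.accCount`): the number of `i < 2ᵏ` whose seed `takeD k (bin i)` makes the referee accept
`⟨⟨x, y⟩, F⟨1^N, seedᵢ⟩ ↾ m⟩`. [cite: AroraBarakCC2009, Lemma 20.3 (proof)] -/
def accCountF (F : List Bool → List Bool) (x y : List Bool) (m N k : ℕ) : ℕ :=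
  ∑ i ∈ Finset.range (2 ^ k),
    (R.boolIndicator (boolPair (boolPair x y)
      ((F (boolPair (ones N) ((encodeNat i).takeD k false))).takeD m false))).toNat

/-- **The count of accepting seeds** of `⟨x, u⟩`: `accCountF` for the table generator armed with the
normalised table, Merlin's normalised message and the scale of `x`. [cite: AroraBarakCC2009, Lemma 20.3 (proof)] -/
def accCount (x u : List Bool) : ℕ :=
  accCountF R (fun W => genTF aK bK (boolPair ((sndP u).takeD (2 ^ ellOf (Nb.eval x.length)) false) W))
    x ((fstP u).takeD (p.eval x.length) false) (p.eval x.length) (Nb.eval x.length) (kOf (Nb.eval x.length))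

/-- **Value of `accF`**: the numeral of `accCount`. [folklore] -/
theorem accF_apply (x u : List Bool) : accF R p Nb (boolPair x u) = encodeNat (accCount R p Nb x u) := by
  have hk : 2 ^ kOf (Nb.eval x.length) ≤ ((PRGDerand.seedPoly (2 ^ bK * aK)).comp Nb).eval (boolPair x u).length := by
    rw [eval_comp]
    refine (two_pow_kOf_le _).trans (TM2Iter.eval_mono _ (TM2Iter.eval_mono _ ?_))
    rw [length_boolPair]; omega
  unfold accF
  rw [cntNumF_apply, show boolPair ([] : List Bool) [] = boolPair (ones 0) (encodeNat 0) by rfl,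
    foldLoop_apply addFn _ hk 0 (encodeNat 0), sndPow_succ_boolPair, sndPow_succ_boolPair, sndPow_zero_boolPair,
    foldAcc_clipF (fun j _ _ => by rw [length_pieceF]; omega), foldAcc_addFn]
  have hb : ∀ b : Bool, bitsToNat [b] = b.toNat := fun b => by rw [bitsToNat_cons]; simp
  simp only [zero_add, accCount, accCountF, genOut, pieceF_apply, hb]

/-- **Value of the majority bit**: `[2^k < 2 · accCount]`. [folklore] -/
theorem majF_apply (x u : List Bool) :
    majF R p Nb (boolPair x u) = [decide (2 ^ kOf (Nb.eval x.length) < 2 * accCount R p Nb x u)] := by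
  unfold majF
  rw [cntNumF_apply, addFn_boolPair, accF_apply, ltFn_boolPair, bitsToNat_encodeNat, bitsToNat_encodeNat,
    bitsToNat_encodeNat, two_mul]

/-- Membership in a set-builder language (local `Iff.rfl` helper). [folklore] -/
theorem memL_setOf' {q : List Bool → Prop} {w : List Bool} :
    @Membership.mem (List Bool) (Language Bool) _ {z | q z} w ↔ q w := Iff.rfl

/-- Membership in an intersection of languages (local `Iff.rfl` helper). [folklore] -/
theorem memL_inf' {L₁ L₂ : Language Bool} {w : List Bool} : w ∈ L₁ ⊓ L₂ ↔ w ∈ L₁ ∧ w ∈ L₂ := Iff.rfl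

/-- **Reading the verifier**: `⟨x, u⟩` is accepted iff the certifier accepts the normalised table and
a majority of seeds accept. [cite: Hirahara2021, Lemma 3.4 (proof sketch, item 2)] -/
theorem mem_Ver_iff (x u : List Bool) : boolPair x u ∈ Ver R p A Nb ↔
    A ((sndP u).takeD (2 ^ ellOf (Nb.eval x.length)) false) (2 ^ ellOf (Nb.eval x.length)) = true ∧
      2 ^ kOf (Nb.eval x.length) < 2 * accCount R p Nb x u := by
  rw [Ver, memL_inf', memL_setOf', memL_setOf', certF_apply, majF_apply]
  simp

end Machine

/-! ### Correctness: seeds versus coins (for an arbitrary generator, as `PRGDerand`) -/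

section Correct

variable (R : Language Bool)

/-- **The seed event** for a generator `F`: the seed strings whose output, truncated to `m` coins,
makes the referee accept `⟨⟨x, y⟩, ·⟩`. [cite: AroraBarakCC2009, Lemma 20.3 (proof)] -/
def seedEventF (F : List Bool → List Bool) (x y : List Bool) (m N : ℕ) : Set (List Bool) :=
  {σ | boolPair (boolPair x y) ((F (boolPair (ones N) σ)).takeD m false) ∈ R}

/-- **The count of accepting seeds is the size of the seed event** (twin of
`PRGDerand.accCount_eq_cnt`). [folklore] -/
theorem accCountF_eq_cnt (F : List Bool → List Bool) (x y : List Bool) (m N k : ℕ) :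
    accCountF R F x y m N k = cnt k (seedEventF R F x y m N) := by
  classical
  rw [accCountF, ← CoinEnum.sum_range_ite_natBits]
  refine Finset.sum_congr rfl fun i hi => ?_
  rw [PRGDerand.takeD_encodeNat_eq_natBits (Finset.mem_range.1 hi)]
  by_cases h : natBits k i ∈ seedEventF R F x y m N
  · rw [if_pos h, (Set.mem_iff_boolIndicator _ _).1 (show _ ∈ R from h)]; rfl
  · rw [if_neg h, (Set.notMem_iff_boolIndicator _ _).1 (show _ ∉ R from h)]; rfl

/-- **The pseudorandom acceptance count** (twin of `PRGDerand.card_seeds_eq_accCount`): for the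
distinguisher `C` of `⟨x, y⟩`, the seeds `s ∈ {0,1}ᵏ` with `C(G(s)) = 1`, `G = seedGenerator F k N`, are
counted by `accCountF`. [cite: AroraBarakCC2009, Lemma 20.3 (proof)] -/
theorem card_seeds_eq_accCountF (F : List Bool → List Bool) (x y : List Bool) {N m k : ℕ} (hmN : m ≤ N)
    (C : Circuit (Fin N))
    (hC : ∀ r, C.eval r = R.boolIndicator (boolPair (boolPair x y) (List.ofFn fun j : Fin m => r (Fin.castLE hmN j)))) :
    #{s : Fin k → Bool | C.eval (seedGenerator F k N s) = true} = accCountF R F x y m N k := by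
  classical
  rw [accCountF_eq_cnt, ← card_filter_ofFn_mem_eq_cnt]
  refine congrArg Finset.card (Finset.filter_congr fun s _ => ?_)
  rw [hC, ← Set.mem_iff_boolIndicator]
  have e : (List.ofFn fun j : Fin m => seedGenerator F k N s (Fin.castLE hmN j)) =
      List.takeD m (F (boolPair (ones N) (List.ofFn s))) false := by
    rw [← ofFn_getD_eq_takeD]
    simp [seedGenerator, OracleCompose.unaryEncodeNat_eq_replicate, ones]
  rw [e]
  rfl

/-- **The gap lemma** (for an arbitrary generator): if `seedGenerator F k N` is `SIZE(N)`-pseudorandom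
(`N ≥ 7`), then for the distinguisher `C` of `⟨x, y⟩` (size `≤ N`, reading `m ≤ N` coins) the fraction
of accepting seeds is within `1/7` of Arthur's acceptance probability `Pr_z[⟨⟨x, y⟩, z⟩ ∈ R]`.
[cite: AroraBarakCC2009, Lemma 20.3 (proof)] -/
theorem abs_sub_le (F : List Bool → List Bool) (x y : List Bool) {N m k : ℕ} (hmN : m ≤ N) (hN7 : 7 ≤ N)
    (hG : IsSizePseudorandom (seedGenerator F k N))
    (C : Circuit (Fin N)) (hB : C.IsOver B2) (hs : C.size ≤ N)
    (hC : ∀ r, C.eval r = R.boolIndicator (boolPair (boolPair x y) (List.ofFn fun j : Fin m => r (Fin.castLE hmN j)))) :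
    |(accCountF R F x y m N k : ℝ) / 2 ^ k - uniformProb m {z : List Bool | boolPair (boolPair x y) z ∈ R}| ≤ 1 / 7 := by
  have hadv := hG C hB hs
  unfold MetaComplexity.prgAdvantage at hadv
  rw [card_seeds_eq_accCountF R F x y hmN C hC, PRGDerand.card_random_eq_uniformProb R (boolPair x y) hmN C hC] at hadv
  refine hadv.trans ?_
  have : (7 : ℝ) ≤ N := by exact_mod_cast hN7
  exact one_div_le_one_div_of_le (by norm_num) this

/-- The table generator of `f` IS the seed generator of `W ↦ genTF ⟨tt(f), W⟩` (definitionally). [folklore] -/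
theorem tableGenerator_eq_seedGenerator {n : ℕ} (a β : ℕ) (f : (Fin n → Bool) → Bool) (k N : ℕ) :
    tableGenerator (genTF a β) f k N = seedGenerator (fun W => genTF a β (boolPair (truthTable f) W)) k N := rfl

end Correct

/-! ### The pseudorandomness of a certified table -/

/-- **A `2^{⌊ℓ/8⌋}`-average-case hard table of arity `ℓ = 24 t(N)` (`t(N) ≥ 3`) makes the table
generator `SIZE(N)`-pseudorandom** (`NWTable.isSizePseudorandom_genTF` with `a = 24`, `β = 25`,
`S = 2^{3t} ≥ max(N², 2^{2t+3})`). [cite: AroraBarakCC2009, Thm. 20.6, Remark 20.8] -/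
theorem isSizePseudorandom_of_avgHard {N : ℕ} (ht : 3 ≤ tOf N) (f : (Fin (aK * tOf N) → Bool) → Bool)
    (hhard : AvgHardAtLeast f ((2 : ℝ) ^ (ellOf N / 8))) :
    IsSizePseudorandom (tableGenerator (genTF aK bK) f (kOf N) N) := by
  have hN : 0 < N := by
    by_contra h0
    have : N = 0 := by omega
    subst this
    simp [tOf] at ht
  have hdiv : ellOf N / 8 = 3 * tOf N := by unfold ellOf aK; omega
  rw [hdiv] at hhard
  have hS2 : (2 : ℝ) ^ (2 * tOf N + 3) ≤ (2 : ℝ) ^ (3 * tOf N) := pow_le_pow_right₀ (by norm_num) (by omega)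
  have hS1 : (N : ℝ) * N ≤ (2 : ℝ) ^ (3 * tOf N) := by
    refine le_trans ?_ hS2
    have h1 : N * N < 2 ^ (2 * tOf N + 3) := by
      have := lt_two_pow_tOf N
      have h2 : N * N < 2 ^ tOf N * 2 ^ tOf N := Nat.mul_lt_mul'' this this
      have h3 : 2 ^ tOf N * 2 ^ tOf N ≤ 2 ^ (2 * tOf N + 3) := by
        rw [← pow_add]; exact Nat.pow_le_pow_right (by norm_num) (by omega)
      omega
    exact_mod_cast h1.le
  exact isSizePseudorandom_genTF (a := aK) (β := bK) (by unfold aK; norm_num) (by unfold aK bK; norm_num) hN f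
    hhard hS1 hS2 (by unfold kOf ellOf bK; ring)

/-! ### The majority arithmetic -/

/-- A `2/3`-probability within `1/7` of the seed fraction gives a majority of seeds. [folklore] -/
theorem majority_of_gap {a k : ℕ} {P : ℝ} (hhi : P - (a : ℝ) / 2 ^ k ≤ 1 / 7) (hP : 2 / 3 ≤ P) :
    2 ^ k < 2 * a := by
  have h2k : (0 : ℝ) < 2 ^ k := by positivity
  have h1 : (1 : ℝ) / 2 < (a : ℝ) / 2 ^ k := by linarith
  rw [lt_div_iff₀ h2k] at h1
  have h2 : ((2 ^ k : ℕ) : ℝ) < ((2 * a : ℕ) : ℝ) := by push_cast; linarith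
  exact_mod_cast h2

/-- A `1/3`-probability within `1/7` of the seed fraction gives a minority of seeds. [folklore] -/
theorem not_majority_of_gap {a k : ℕ} {P : ℝ} (hlo : (a : ℝ) / 2 ^ k - P ≤ 1 / 7) (hP : P ≤ 1 / 3) :
    ¬ 2 ^ k < 2 * a := by
  have h2k : (0 : ℝ) < 2 ^ k := by positivity
  have h1 : (a : ℝ) / 2 ^ k < 1 / 2 := by linarith
  rw [div_lt_iff₀ h2k] at h1
  intro hlt
  have h2 : ((2 ^ k : ℕ) : ℝ) < ((2 * a : ℕ) : ℝ) := by exact_mod_cast hlt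
  push_cast at h2
  linarith

/-! ### The theorem -/

/-- **`pr-MA ⊆ pr-NP` from a certifier of average-case hard tables.** If a polynomial-time `A(w; 1ⁿ)`
accepts only truth tables `tt(f)` (`f` of arity `ℓ`, read at `n = 2^ℓ`) with `H_avg(f) ≥ 2^{⌊ℓ/8⌋}`,
and accepts SOME table of every arity `ℓ ≥ ℓ₀`, then every `pr-MA` problem is in `pr-NP`: the
`NP` witness for `x` is Merlin's message together with an accepted table of arity `24 t(N)`,
`N = Nb(|x|)`; the verifier `KSDerand.Ver` checks the table and takes the majority vote of Arthur's
predicate over all outputs of the table generator (`mem_Ver_iff`, `abs_sub_le`,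
`isSizePseudorandom_of_avgHard`; the distinguisher is `exists_circuit_hardwire` at the polynomial
output length `Nb`). [Hirahara 2021, Lemma 3.4 (proof sketch, item 2); Köbler–Schuler 2004;
Impagliazzo–Kabanets–Wigderson 2002, §2.4] [cite: Hirahara2021, Lemma 3.4 (proof sketch, item 2)] -/
theorem PromiseMA'_subset_PromiseNP_of_avgCertifier (A : List Bool → ℕ → Bool) (ℓ₀ : ℕ)
    (hA : PolyTimeComputable paramEnc encodeBool (Function.uncurry A))
    (hsound : ∀ (ℓ : ℕ) (f : (Fin ℓ → Bool) → Bool), A (truthTable f) (2 ^ ℓ) = true →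
      AvgHardAtLeast f ((2 : ℝ) ^ (ℓ / 8)))
    (hne : ∀ ℓ : ℕ, ℓ₀ ≤ ℓ → ∃ f : (Fin ℓ → Bool) → Bool, A (truthTable f) (2 ^ ℓ) = true) :
    PromiseMA' ⊆ PromiseNP := by
  intro Q hQ
  obtain ⟨R, hR, p, hyes, hno⟩ := hQ
  obtain ⟨q, hq⟩ := exists_cktSize_boolPair_of_mem_PPoly (P_subset_PPoly_holds hR)
  -- the output length `N(n)`: above the distinguisher size, the coin count, `7` and `2^{ℓ₀}`
  let Sz : Polynomial ℕ := 4 * X + 6 + 3 * p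
  let Nb : Polynomial ℕ := Sz + q.comp Sz + 2 + X + p + Polynomial.C (2 ^ ℓ₀ + 7)
  have hNb : ∀ n, Nb.eval n =
      (4 * n + 6 + 3 * p.eval n) + q.eval (4 * n + 6 + 3 * p.eval n) + 2 + n + p.eval n + (2 ^ ℓ₀ + 7) := by
    intro n; simp [Nb, Sz]
  -- the verifier and the `NP` language
  let V : Language Bool := Ver R p A Nb
  have hV : V ∈ Classes.P := Ver_mem_P p Nb hR hA
  let wl : Polynomial ℕ := 2 * p + 2 + Tpoly.comp Nb
  let L : Language Bool := {x | ∃ u : List Bool, u.length ≤ wl.eval x.length ∧ boolPair x u ∈ V}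
  have hL : L ∈ Nondeterministic.NP := ⟨V, hV, wl, fun x => Iff.rfl⟩
  -- facts about the scale, for every input length
  have hscale : ∀ n : ℕ, p.eval n ≤ Nb.eval n ∧ 7 ≤ Nb.eval n ∧ 3 ≤ tOf (Nb.eval n) ∧ ℓ₀ ≤ ellOf (Nb.eval n) ∧
      (4 * n + 6 + 3 * p.eval n) + q.eval (4 * n + 6 + 3 * p.eval n) + 2 ≤ Nb.eval n := by
    intro n
    have h1 := hNb n
    have hd : 1 ≤ 2 ^ ℓ₀ := Nat.one_le_two_pow
    have hlog : ℓ₀ ≤ Nat.log 2 (Nb.eval n) := Nat.le_log_of_pow_le one_lt_two (by rw [h1]; omega)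
    have hlog2 : 2 ≤ Nat.log 2 (Nb.eval n) :=
      Nat.le_log_of_pow_le one_lt_two (by rw [h1]; norm_num; omega)
    refine ⟨by rw [h1]; omega, by rw [h1]; omega, by unfold tOf; omega, ?_, by rw [h1]; omega⟩
    unfold ellOf aK tOf; omega
  refine ⟨L, hL, fun x hx => ?_, fun x hx hxL => ?_⟩
  · -- YES: Merlin's good message and a certified table of arity `ℓ(N)`
    obtain ⟨y₀, hy₀, hpr⟩ := hyes x hx
    obtain ⟨hmN, hN7, ht3, hℓ₀, hsz⟩ := hscale x.length
    obtain ⟨f₀, hf₀⟩ := hne (ellOf (Nb.eval x.length)) hℓ₀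
    -- the witness `u = ⟨y₀, tt(f₀)⟩` and its normalisations
    have hρ : (sndP (boolPair y₀ (truthTable f₀))).takeD (2 ^ ellOf (Nb.eval x.length)) false = truthTable f₀ := by
      rw [sndP_boolPair]; exact takeD_of_length_eq (length_truthTable _)
    have hy : (fstP (boolPair y₀ (truthTable f₀))).takeD (p.eval x.length) false = y₀ := by
      rw [fstP_boolPair]; exact takeD_of_length_eq hy₀
    refine ⟨boolPair y₀ (truthTable f₀), ?_, ?_⟩
    · -- witness length
      have hT := two_pow_ellOf_le (Nb.eval x.length)
      have hTl : (truthTable f₀).length = 2 ^ ellOf (Nb.eval x.length) := length_truthTable _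
      simp only [length_boolPair, wl, eval_add, eval_mul, eval_ofNat, eval_comp]
      omega
    · show boolPair x (boolPair y₀ (truthTable f₀)) ∈ Ver R p A Nb
      rw [mem_Ver_iff]
      refine ⟨by rw [hρ]; exact hf₀, ?_⟩
      -- the distinguisher of `⟨x, y₀⟩`
      obtain ⟨C, hB, hs, hC⟩ :=
        exists_circuit_hardwire (hq (boolPair x y₀).length (p.eval x.length)) (boolPair x y₀) rfl hmN
      have hsN : C.size ≤ Nb.eval x.length := by
        have hlen : (boolPair x y₀).length = 2 * x.length + 2 + p.eval x.length := by rw [length_boolPair, hy₀]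
        have harg : 2 * (boolPair x y₀).length + 2 + p.eval x.length = 4 * x.length + 6 + 3 * p.eval x.length := by
          rw [hlen]; ring
        rw [harg] at hs
        omega
      -- the generator of the certified table fools it
      have hG := isSizePseudorandom_of_avgHard ht3 f₀ (hsound _ f₀ hf₀)
      rw [tableGenerator_eq_seedGenerator, ← hρ] at hG
      rw [← hy] at hC hpr
      have hgap := abs_sub_le R _ x _ hmN hN7 hG C hB hsN hC
      obtain ⟨-, hhi⟩ := abs_sub_le_iff.1 hgap
      -- `acc / 2^k ≥ 2/3 - 1/7 > 1/2`
      exact majority_of_gap hhi hpr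
  · -- NO: every accepted table is hard, so no witness is accepted
    obtain ⟨u, -, hu⟩ := hxL
    obtain ⟨hmN, hN7, ht3, -, hsz⟩ := hscale x.length
    have hu' : boolPair x u ∈ Ver R p A Nb := hu
    rw [mem_Ver_iff] at hu'
    obtain ⟨hcert, hmaj⟩ := hu'
    -- the normalised table is a certified, hence hard, truth table
    have hρlen : ((sndP u).takeD (2 ^ ellOf (Nb.eval x.length)) false).length = 2 ^ (aK * tOf (Nb.eval x.length)) :=
      List.takeD_length _ _ _
    have htf : truthTable (ofTruthTable _ hρlen) = (sndP u).takeD (2 ^ ellOf (Nb.eval x.length)) false :=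
      truthTable_ofTruthTable _ hρlen
    have hhard : AvgHardAtLeast (ofTruthTable _ hρlen) ((2 : ℝ) ^ (ellOf (Nb.eval x.length) / 8)) :=
      hsound _ _ (by rw [htf]; exact hcert)
    have hG := isSizePseudorandom_of_avgHard ht3 _ hhard
    rw [tableGenerator_eq_seedGenerator, htf] at hG
    -- the normalised message and its distinguisher
    have hylen : ((fstP u).takeD (p.eval x.length) false).length = p.eval x.length := List.takeD_length _ _ _
    obtain ⟨C, hB, hs, hC⟩ := exists_circuit_hardwire
      (hq (boolPair x ((fstP u).takeD (p.eval x.length) false)).length (p.eval x.length))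
      (boolPair x ((fstP u).takeD (p.eval x.length) false)) rfl hmN
    have hsN : C.size ≤ Nb.eval x.length := by
      have hlen : (boolPair x ((fstP u).takeD (p.eval x.length) false)).length = 2 * x.length + 2 + p.eval x.length := by
        rw [length_boolPair, hylen]
      have harg : 2 * (boolPair x ((fstP u).takeD (p.eval x.length) false)).length + 2 + p.eval x.length =
          4 * x.length + 6 + 3 * p.eval x.length := by
        rw [hlen]; ring
      rw [harg] at hs
      omega
    have hgap := abs_sub_le R _ x _ hmN hN7 hG C hB hsN hC
    obtain ⟨hlo, -⟩ := abs_sub_le_iff.1 hgap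
    -- Arthur rejects the normalised message with probability `≥ 2/3`
    have hpr := hno x hx _ hylen
    -- `acc / 2^k ≤ 1/3 + 1/7 < 1/2`, contradicting the majority
    exact not_majority_of_gap hlo hpr hmaj

end KSDerand

/-! ### Under the average-case hypotheses -/

open KSDerand in
/-- **Köbler–Schuler: `pr-MA ⊆ pr-NP` under `coNP × {U} ⊆ Avg¹_{1-n^{-c}} P`** (the uniform half of
Hirahara's hypothesis suffices), through the certifier of `AvgHardTablesNP.lean`.
[Hirahara 2021 (ECCC TR21-058), Lemma 3.4, proof sketch, item 2 (p. 20); Köbler–Schuler 2004]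
[cite: Hirahara2021, Lemma 3.4 (proof sketch, item 2)] -/
theorem PromiseMA'_subset_PromiseNP_of_uniform
    (hU : ∃ c : ℕ, distClass coNP {uniformEnsemble} ⊆ Avg1DeltaP fun n => 1 - 1 / (n : ℝ) ^ c) :
    PromiseMA' ⊆ PromiseNP := by
  obtain ⟨A, c, ℓ₀, hA, hsound, -, hne⟩ := exists_avgCertifier_of_uniform hU
  exact PromiseMA'_subset_PromiseNP_of_avgCertifier A ℓ₀ hA hsound hne

/-- **`pr-MA = pr-NP` under `coNP × {U} ⊆ Avg¹_{1-n^{-c}} P`** (with the trivial `pr-NP ⊆ pr-MA`,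
`PromiseNP_subset_PromiseMA'`). [cite: Hirahara2021, Lemma 3.4 (proof sketch, item 2)] -/
theorem PromiseMA'_eq_PromiseNP_of_uniform
    (hU : ∃ c : ℕ, distClass coNP {uniformEnsemble} ⊆ Avg1DeltaP fun n => 1 - 1 / (n : ℝ) ^ c) :
    PromiseMA' = PromiseNP :=
  Set.Subset.antisymm (PromiseMA'_subset_PromiseNP_of_uniform hU) PromiseNP_subset_PromiseMA'

/-- **Hirahara 2021, Lemma 3.4, proof sketch, item 2** ("`coNP × {U} ⊆ Avg¹_{1-n^{-c}} P` implies
`pr-MA = pr-NP` [KS04]"), under the hypothesis of `Hirahara2021_UP_searchUHS_of_Avg1P`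
(`coNP × {U, T} ⊆ Avg¹_{1-n^{-c}} P`): `pr-MA ⊆ pr-NP`.
[cite: Hirahara2021, Lemma 3.4 (proof sketch, item 2)] -/
theorem Hirahara2021_PromiseMA'_subset_PromiseNP_of_Avg1P
    (hyp : ∃ c : ℕ, distClass coNP {uniformEnsemble, tallyEnsemble} ⊆
      Avg1DeltaP fun n => 1 - 1 / (n : ℝ) ^ c) :
    PromiseMA' ⊆ PromiseNP :=
  PromiseMA'_subset_PromiseNP_of_uniform (distClass_coNP_uniform_subset_Avg1DeltaP_of_weak hyp)

/-- **Hirahara 2021, Lemma 3.4, proof sketch, item 2, as printed: `pr-MA = pr-NP`** under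
`coNP × {U, T} ⊆ Avg¹_{1-n^{-c}} P`. [cite: Hirahara2021, Lemma 3.4 (proof sketch, item 2)] -/
theorem Hirahara2021_PromiseMA'_eq_PromiseNP_of_Avg1P
    (hyp : ∃ c : ℕ, distClass coNP {uniformEnsemble, tallyEnsemble} ⊆
      Avg1DeltaP fun n => 1 - 1 / (n : ℝ) ^ c) :
    PromiseMA' = PromiseNP :=
  PromiseMA'_eq_PromiseNP_of_uniform (distClass_coNP_uniform_subset_Avg1DeltaP_of_weak hyp)

/-- **Corollary: `MA ⊆ NP`** under `coNP × {U, T} ⊆ Avg¹_{1-n^{-c}} P` (the language form, for the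
tree's game class `MA`). [cite: Hirahara2021, Lemma 3.4 (proof sketch, item 2)] -/
theorem Hirahara2021_MA_subset_NP_of_Avg1P
    (hyp : ∃ c : ℕ, distClass coNP {uniformEnsemble, tallyEnsemble} ⊆
      Avg1DeltaP fun n => 1 - 1 / (n : ℝ) ^ c) :
    MA ⊆ Nondeterministic.NP :=
  MA_subset_NP_of_PromiseMA'_subset_PromiseNP (Hirahara2021_PromiseMA'_subset_PromiseNP_of_Avg1P hyp)

end Literature.Computability.MetaComplexity

end
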